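import Summits.Ventures.PercRepro.RankLevelSetFrameQM
import Summits.Ventures.PercRepro.RankLevelSetFrameCross

/-!
# PercRepro — C-025 at level `q + 1`: the wrapper with EVERY landed reduction folded in (night-1, gen 0)

`rls_succ_all_full` is `rls_succ_all` (`RankLevelSetFrameQ`) with four more cases routed inside the same strong induction on
`|E|`: `|E| < p + q + 1` (empty `U`), `|E| = p + q + 1` (p3's Theorem M), every circuit of size `≥ q + 3` (p3's Theorem G′), and an
element whose cross term is non-positive (`RLS_of_freeCount_le`, from the exact identities of `RankLevelSetCrossStep`). The
core hypothesis is therefore: SIMPLE, RANK `p`, COLOOP-FREE, every element with an `e`-free partition, `p + (q + 1) < |E|`,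
a circuit with `≤ q + 2` elements, and `n⁰⁰_{p−1,q}(e) < n⁰⁰_{p−1,q+1}(e)` at every element. `CoreThreeFull` names it at `q = 3`
and `c025_three_of_coreThreeFull` is the reduction. Axioms: standard.
-/

open scoped Matroid

namespace PercRepro

namespace ThmN

variable {α : Type}

/-- **The wrapper at level `q + 1` with every landed reduction folded in** (the body of `rls_succ_all` with four more
cases): the core may assume simplicity, rank `p`, no coloops, an `e`-free partition for every element,
`p + (q + 1) < |E|` (Theorem M below), a circuit with `≤ q + 2` elements (Theorem G′ otherwise), and a positive cross term
`n⁰⁰_{p−1,q}(e) < n⁰⁰_{p−1,q+1}(e)` at every element. -/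
theorem rls_succ_all_full (q : ℕ)
    (hprev : ∀ (M : Matroid α) [M.Finite] (p : ℕ), q + 2 ≤ p → RLS M p q)
    (hcore : ∀ (M : Matroid α) [M.Finite] (p : ℕ), q + 3 ≤ p →
      (∀ e ∈ M.E, ∀ f ∈ M.E, e ≠ f → M.eRk {e, f} = 2) → M.eRank = (p : ℕ∞) →
      (∀ e, ¬ M.IsColoop e) →
      (∀ e ∈ M.E, ∃ A ⊆ M.E \ {e}, e ∉ M.closure A ∧ e ∉ M.closure ((M.E \ {e}) \ A)) →
      p + (q + 1) < M.E.ncard → (∃ C, M.IsCircuit C ∧ C.encard < ((q + 3 : ℕ) : ℕ∞)) →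
      (∀ e ∈ M.E, Matroid.freeCount M e (p - 1) q < Matroid.freeCount M e (p - 1) (q + 1)) → RLS M p (q + 1)) :
    ∀ (M : Matroid α) [M.Finite] (p : ℕ), q + 3 ≤ p → RLS M p (q + 1) := by
  suffices H : ∀ n : ℕ, ∀ (M : Matroid α) [M.Finite], M.E.ncard = n → ∀ p : ℕ, q + 3 ≤ p →
      RLS M p (q + 1) from fun M _ p hp => H _ M rfl p hp
  intro n
  induction n using Nat.strong_induction_on with
  | _ n ih =>
  intro M _ hn p hp
  classical
  have hdel : ∀ e ∈ M.E, (M ＼ {e}).E.ncard < n := by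
    intro e he
    rw [_root_.Matroid.delete_ground, ← hn, ← Set.ncard_sdiff_singleton_add_one he M.ground_finite]
    omega
  -- Case 1: a loop
  by_cases hL : ∃ e ∈ M.E, M.IsLoop e
  · obtain ⟨e, he, hloopE⟩ := hL
    exact RLS_of_loop_q M hloopE p (q + 1) (ih _ (hdel e he) (M ＼ {e}) rfl p hp)
  push Not at hL
  -- Case 2: a parallel pair
  by_cases hP : ∃ e ∈ M.E, ∃ e' ∈ M.E, e' ≠ e ∧ e ∈ M.closure {e'}
  · obtain ⟨e, he, e', he', hne, hpar⟩ := hP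
    have heI : M.Indep {e} := _root_.Matroid.indep_singleton.2 ((_root_.Matroid.not_isLoop_iff he).1 (hL e he))
    obtain ⟨p', rfl⟩ : ∃ p', p = p' + 1 := ⟨p - 1, by omega⟩
    exact RLS_of_parallel_q M heI he' hne hpar (ih _ (hdel e he) (M ＼ {e}) rfl (p' + 1) hp)
      (hprev (M ／ {e}) p' (by omega))
  push Not at hP
  -- Case 3: simple
  have hs : ∀ e ∈ M.E, ∀ f ∈ M.E, e ≠ f → M.eRk {e, f} = 2 :=
    fun e he f hf hef => eRk_pair_eq_two_of_simple M hL (fun e he e' he' hne => hP e he e' he' hne) he hf hef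
  rcases lt_trichotomy M.eRank (p : ℕ∞) with hlt | heq | hgt
  · exact RLS_of_eRank_lt M hlt
  · -- `r(E) = p`
    by_cases hC : ∃ e, M.IsColoop e
    · obtain ⟨e, hcol⟩ := hC
      obtain ⟨p', rfl⟩ : ∃ p', p = p' + 1 := ⟨p - 1, by omega⟩
      refine RLS_of_coloop_q M (by omega) hcol heq ?_
      rcases Nat.lt_or_ge (q + 2) p' with h | h
      · exact ih _ (hdel e hcol.mem_ground) (M ＼ {e}) rfl p' (by omega)
      · exact RLS_of_le (M ＼ {e}) (by omega)
    · push Not at hC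
      -- an element without an `e`-free partition closes the step
      by_cases hU : ∃ e ∈ M.E, ∀ A ⊆ M.E \ {e}, e ∈ M.closure A ∨ e ∈ M.closure ((M.E \ {e}) \ A)
      · obtain ⟨e, he, hunsp⟩ := hU
        have heI : M.Indep {e} := _root_.Matroid.indep_singleton.2 ((_root_.Matroid.not_isLoop_iff he).1 (hL e he))
        obtain ⟨p', rfl⟩ : ∃ p', p = p' + 1 := ⟨p - 1, by omega⟩
        exact RLS_of_unspanned_q M heI hunsp (ih _ (hdel e he) (M ＼ {e}) rfl (p' + 1) hp)
          (hprev (M ／ {e}) p' (by omega))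
      · push Not at hU
        -- an element with a non-positive cross term closes the step
        by_cases hZ : ∃ e ∈ M.E, Matroid.freeCount M e (p - 1) (q + 1) ≤ Matroid.freeCount M e (p - 1) q
        · obtain ⟨e, he, h0⟩ := hZ
          have heI : M.Indep {e} :=
            _root_.Matroid.indep_singleton.2 ((_root_.Matroid.not_isLoop_iff he).1 (hL e he))
          obtain ⟨p', rfl⟩ : ∃ p', p = p' + 1 := ⟨p - 1, by omega⟩
          rw [Nat.add_sub_cancel] at h0
          exact RLS_of_freeCount_le M heI heq h0 (ih _ (hdel e he) (M ＼ {e}) rfl (p' + 1) hp)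
            (hprev (M ／ {e}) p' (by omega))
        · push Not at hZ
          rcases lt_trichotomy M.E.ncard (p + (q + 1)) with hlt | hEq | hgt'
          · exact RLS_of_ncard_lt M hlt
          · exact RLS_of_ncard_eq M hEq
          · by_cases hG : ∀ C, M.IsCircuit C → ((q + 1 + 2 : ℕ) : ℕ∞) ≤ C.encard
            · exact RLS_of_circuits M hG
            · push Not at hG
              obtain ⟨C, hCc, hlt'⟩ := hG
              exact hcore M p hp hs heq hC (fun e he => by
                obtain ⟨A, hA, h⟩ := hU e he
                exact ⟨A, hA, h.1, h.2⟩) hgt' ⟨C, hCc, by rw [show q + 3 = q + 1 + 2 by ring]; exact hlt'⟩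
                (fun e he => hZ e he)
  · -- `r(E) > p`: truncate, then the same dichotomy on the truncation (same ground set, so the same size)
    have hp2 : 2 ≤ p := by omega
    set T := Matroid.truncate M p with hTdef
    have hTs := truncate_pair_eRk M hp2 hs
    have hTR := truncate_eRank_eq M hgt
    have hTc := truncate_no_coloop M hgt
    have hTE : T.E = M.E := Matroid.truncate_ground M p
    have hT : RLS T p (q + 1) := by
      by_cases hU : ∃ e ∈ T.E, ∀ A ⊆ T.E \ {e}, e ∈ T.closure A ∨ e ∈ T.closure ((T.E \ {e}) \ A)
      · obtain ⟨e, he, hunsp⟩ := hU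
        have heT : T.Indep {e} := by
          rw [Matroid.truncate_indep_iff]
          refine ⟨_root_.Matroid.indep_singleton.2 ((_root_.Matroid.not_isLoop_iff (hTE ▸ he)).1 (hL e (hTE ▸ he))), ?_⟩
          rw [Set.ncard_singleton]; omega
        have hdelT : (T ＼ {e}).E.ncard < n := by
          rw [_root_.Matroid.delete_ground, hTE, ← hn, ← Set.ncard_sdiff_singleton_add_one (hTE ▸ he) M.ground_finite]
          omega
        obtain ⟨p', rfl⟩ : ∃ p', p = p' + 1 := ⟨p - 1, by omega⟩
        exact RLS_of_unspanned_q T heT hunsp (ih _ hdelT (T ＼ {e}) rfl (p' + 1) hp)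
          (hprev (T ／ {e}) p' (by omega))
      · push Not at hU
        by_cases hZ : ∃ e ∈ T.E, Matroid.freeCount T e (p - 1) (q + 1) ≤ Matroid.freeCount T e (p - 1) q
        · obtain ⟨e, he, h0⟩ := hZ
          have heT : T.Indep {e} := by
            rw [Matroid.truncate_indep_iff]
            refine ⟨_root_.Matroid.indep_singleton.2 ((_root_.Matroid.not_isLoop_iff (hTE ▸ he)).1 (hL e (hTE ▸ he))), ?_⟩
            rw [Set.ncard_singleton]; omega
          have hdelT : (T ＼ {e}).E.ncard < n := by
            rw [_root_.Matroid.delete_ground, hTE, ← hn, ← Set.ncard_sdiff_singleton_add_one (hTE ▸ he) M.ground_finite]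
            omega
          obtain ⟨p', rfl⟩ : ∃ p', p = p' + 1 := ⟨p - 1, by omega⟩
          rw [Nat.add_sub_cancel] at h0
          exact RLS_of_freeCount_le T heT hTR h0 (ih _ hdelT (T ＼ {e}) rfl (p' + 1) hp)
            (hprev (T ／ {e}) p' (by omega))
        · push Not at hZ
          rcases lt_trichotomy T.E.ncard (p + (q + 1)) with hlt | hEq | hgt'
          · exact RLS_of_ncard_lt T hlt
          · exact RLS_of_ncard_eq T hEq
          · by_cases hG : ∀ C, T.IsCircuit C → ((q + 1 + 2 : ℕ) : ℕ∞) ≤ C.encard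
            · exact RLS_of_circuits T hG
            · push Not at hG
              obtain ⟨C, hCc, hlt'⟩ := hG
              exact hcore T p hp hTs hTR hTc (fun e he => by
                obtain ⟨A, hA, h⟩ := hU e he
                exact ⟨A, hA, h.1, h.2⟩) hgt' ⟨C, hCc, by rw [show q + 3 = q + 1 + 2 by ring]; exact hlt'⟩
                (fun e he => hZ e he)
    unfold RLS at hT ⊢
    exact Matroid.rls_of_truncate M p (by omega) (phiK p (q + 1)) (by unfold phiK; positivity) hT



end ThmN

/-- **The open core of C-025 at `q = 3`, with every landed reduction folded in.** -/
def CoreThreeFull : Prop :=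
  ∀ {α : Type} (M : Matroid α) [M.Finite] (p : ℕ), 5 ≤ p →
    (∀ e ∈ M.E, ∀ f ∈ M.E, e ≠ f → M.eRk {e, f} = 2) → M.eRank = (p : ℕ∞) →
    (∀ e, ¬ M.IsColoop e) →
    (∀ e ∈ M.E, ∃ A ⊆ M.E \ {e}, e ∉ M.closure A ∧ e ∉ M.closure ((M.E \ {e}) \ A)) →
    p + 3 < M.E.ncard → (∃ C, M.IsCircuit C ∧ C.encard < ((5 : ℕ) : ℕ∞)) →
    (∀ e ∈ M.E, Matroid.freeCount M e (p - 1) 2 < Matroid.freeCount M e (p - 1) 3) →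
    phiK p 3 * ({A : Set α | A ⊆ M.E ∧ M.eRk A = (p : ℕ∞) ∧ M.eRk (M.E \ A) = ((3 : ℕ) : ℕ∞)}.ncard : ℚ) ≤
      ({A : Set α | A ⊆ M.E ∧ ((3 : ℕ) : ℕ∞) < M.eRk A ∧ M.eRk A < (p : ℕ∞)}.ncard : ℚ)

/-- **The reduction of record with every landed reduction**: `CoreThreeFull` gives the `C025` body at every `(p, 3)`,
`p ≥ 5`, on every finite matroid. -/
theorem c025_three_of_coreThreeFull (h : CoreThreeFull) {α : Type} (M : Matroid α) [M.Finite] (p : ℕ) (hp : 5 ≤ p) :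
    phiK p 3 * ({A : Set α | A ⊆ M.E ∧ M.eRk A = (p : ℕ∞) ∧ M.eRk (M.E \ A) = ((3 : ℕ) : ℕ∞)}.ncard : ℚ) ≤
      ({A : Set α | A ⊆ M.E ∧ ((3 : ℕ) : ℕ∞) < M.eRk A ∧ M.eRk A < (p : ℕ∞)}.ncard : ℚ) :=
  ThmN.rls_succ_all_full 2 (fun M _ p hp => ThmN.c025_two_all M p hp)
    (fun M _ p hp hs hR hcol hfree hn hC hcross => by
      have hC' : ∃ C, M.IsCircuit C ∧ C.encard < ((5 : ℕ) : ℕ∞) := by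
        obtain ⟨C, hCc, hlt⟩ := hC
        exact ⟨C, hCc, by simpa using hlt⟩
      exact h M p hp hs hR hcol hfree hn hC' hcross) M p hp

end PercRepro
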